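import Summits.Ventures.CertifiedQuantumChemistry.Rows.HubbardRingTVGroundStateEnergyPerSite
import Summits.Ventures.CertifiedQuantumChemistry.Rows.HubbardRingTVDihedralSymmetrySinglet
import Summits.Ventures.CertifiedQuantumChemistry.Rows.HubbardRingTVWeakCoupling
import HarnessLib

/-!
# Ventures/CertifiedQuantumChemistry — Rows/HubbardRingTVGapDecomposition.lean: the certified GAP PER SITE
# of the half-filled even TV-H ring decomposes as `(E₀ − OPT_X)/L = 2t·(bond excess) + U·(doublon deficit)`
# of a symmetric optimiser against the exact ground state, at BOTH registered levels; hence the optimiser's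
# doublon excess is bounded by `2t/U ×` its bond excess — the 'delocalisation' sentence as an inequality;
# and both readings jointly: linear majorants of `OPT_DQG` and `E₀` over the whole `(t, U)` plane

HONEST FRAMING (verbatim): certified bounds for a stated model Hamiltonian in a stated basis; not a
claim about the real molecule beyond that model. Nothing here is a certificate, a row, a claim node or a
value of record; the statements are identities / inequalities between the VALUES `E₀`, `OPT_DQG`,
`OPT_DQG+S²` of the cell's model object `hubbardRingTV (2n) t U` and one-site entries of ARBITRARY
rotation-invariant optimal pairs and of the exact ground state; no certified primal point is read.

Seat rdm-B, ROWS courtesy file (theorems only; no `def`, no notation, no instance; zero compute). This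
gen's `Rows/HubbardRingTVEnergyFormula.lean` gives `OPT_DQG/L = −2t·Σ_σ Re b_σ + U·Re d` at a dihedral-
invariant optimum and `Rows/HubbardRingTVGroundStateEnergyPerSite.lean` gives `E₀/L = −4t·Re B + U·Re D`
in the (unique, Lieb) half-filled ground state; subtracting types HOME/STRUCTURE.md §2.2.8 (vi) ("the
certified ENERGY error of S-U is … a DELOCALISATION error sitting in ONE primal observable — too many
doubly-occupied sites bought with too much kinetic energy") as an exact statement valid at EVERY `(t, U)`,
with no asymptotics and no reading of solver output:

* §1 **`hubbardRingTV_exists_singlet_optimum_eq_mul_site`** — the singlet level of the per-site value: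
  for `L ≥ 3`, `n ≤ L`, a dihedral-invariant OPTIMAL pair of the singlet-restricted programme exists (gen
  38's `hubbardRingTV_exists_dihedral_singlet_optimum`) and `OPT_DQG+S²(L; t, U; n) = L·(−2t Σ_σ Re b_σ +
  U Re d)` at every site.
* §2 (sector level, `L = 2n ≥ 4`, `t ≠ 0`, `U > 0`, unit ground state `ψ`, rotation-invariant optimal pair)
  **`hubbardRingTV_gap_sector_eq_mul_site`**:
  `E₀ − OPT_DQG = 2n·(2t·(Σ_σ Re b_σ − 2 Re B) + U·(Re D − Re d))`;
  **`hubbardRingTV_doublonExcess_le_bondExcess`**: `U·(Re d − Re D) ≤ 2t·(Σ_σ Re b_σ − 2 Re B)` (the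
  relaxation lies below `E₀`: an optimiser with MORE doublons than the ground state has MORE bond
  amplitude); `hubbardRingTV_gap_sector_le_bondExcess_add` (one-sided form dropping `Re d ≥ 0`).
* §3 the same at the SINGLET level (`hubbardRingTV_gap_singlet_eq_mul_site`,
  `hubbardRingTV_doublonExcess_le_bondExcess_singlet`, via gen 38's `OPT_DQG+S² ≤ E₀` =
  `hubbardRingTV_pqgSingletEnergy_le_energy`), and the EXISTENCE FORM
  **`hubbardRingTV_exists_optima_doublonExcess_le_bondExcess`**: for every unit ground state there are
  dihedral-invariant optimal pairs at both levels obeying the inequality.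
* §4 the two readings JOINTLY, over the whole `(t, U)` plane: **`hubbardRingTV_pqgSectorEnergy_le_mul_site`**
  — a rotation-invariant feasible pair majorises `OPT_DQG(L; t′, U′; a, b) ≤ L·(−2t′·Σ_σ Re b_σ + U′·Re d)`
  for EVERY `(t′, U′)` (equality where it is optimal: `(−2K, s)` is a joint supergradient of the concave,
  positively homogeneous value, Euler's identity); `hubbardRingTV_groundState_expect_eq_mul_site_plane` and
  **`hubbardRingTV_energy_le_mul_site_plane`** — the exact twin `E₀(2n; t′, U′; n, n) ≤ 2n·(−4t′·Re B +
  U′·Re D)` for a unit ground state at `(t, U)`, uniting the hopping (this gen's `…BondSupergradient`) and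
  the repulsion (gen 38's `…DoubleOccupancyMonotone`) Feynman–Hellmann inequalities.

All PROVED (0 sorry, standard axioms); no defs, no named facts. References (docstring-only): as in the two
siblings; D. A. Mazziotti, Adv. Chem. Phys. 134 (2007) ch. 3 §II (the programme). Tree (REUSED):
`RingEnergy.hubbardRingTV_re_rdmEnergy_eq_mul_site`, `hubbardRingTV_energy_eq_mul_site` (this gen),
`hubbardRingTV_exists_dihedral_optimum` / `hubbardRingTV_exists_dihedral_singlet_optimum` /
`RingSymmetry.entrywise_of_submatrix` / `hubbardRingTV_pqgSingletEnergy_le_energy` (gen 38),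
`pqgSectorEnergy_le_sectorGroundEnergy`.
-/

noncomputable section

namespace Summit.Ventures.CertifiedQuantumChemistry

open Matrix Finset
open Literature.MathematicalPhysics.QuantumLattice Literature.MathematicalPhysics.QuantumChemistry
open Summit.Ventures.CertifiedQuantumChemistry.Hamiltonians
open scoped ComplexOrder

namespace RingEnergy

open RingSymmetry

/-! ## §1 The singlet level: `OPT_DQG+S²/L` at a dihedral-invariant singlet optimum -/

section Singlet

variable {L : ℕ}

/-- **`OPT_DQG+S²/L` AT A SYMMETRIC SINGLET OPTIMUM, `L ≥ 3`.** For every `t, U` and `n ≤ L` the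
singlet-restricted programme of `hubbardRingTV L t U` has an optimal feasible pair, invariant under every
rotation and reflection of the sites (gen 38's `hubbardRingTV_exists_dihedral_singlet_optimum`), at which
for EVERY site `p₀`: `OPT_DQG+S²(L; t, U; n) = L · (−2t Σ_σ Re γ_{p₀σ,(p₀+1)σ} + U Re Γ_{(p₀↑,p₀↓),(p₀↑,p₀↓)})`.
[folklore] -/
theorem hubbardRingTV_exists_singlet_optimum_eq_mul_site (hL : 3 ≤ L) (t U : ℚ) {n : ℕ} (hn : n ≤ L) :
    ∃ γ Γ, IsDQGFeasibleSinglet n γ Γ ∧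
      (∀ x ∈ Subgroup.closure ({finRotate L, Fin.revPerm} : Set (Equiv.Perm (Fin L))),
          γ.submatrix (Orb.mapEquiv x) (Orb.mapEquiv x) = γ ∧
            Γ.submatrix (Prod.map (Orb.mapEquiv x) (Orb.mapEquiv x))
              (Prod.map (Orb.mapEquiv x) (Orb.mapEquiv x)) = Γ) ∧
      ∀ p₀ : Fin L, Model.pqgSingletEnergy (hubbardRingTV L t U) n =
        L * (-2 * (t : ℝ) * ∑ σ : Fin 2, (γ (orb p₀ σ) (orb (finRotate L p₀) σ)).re +
          (U : ℝ) * (Γ (orb p₀ 0, orb p₀ 1) (orb p₀ 0, orb p₀ 1)).re) := by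
  obtain ⟨γ, Γ, hf, hinv, hE⟩ := hubbardRingTV_exists_dihedral_singlet_optimum (L := L) t U hn
  have hr : finRotate L ∈ Subgroup.closure ({finRotate L, Fin.revPerm} : Set (Equiv.Perm (Fin L))) :=
    Subgroup.subset_closure (Set.mem_insert _ _)
  obtain ⟨hγ, hΓ⟩ := entrywise_of_submatrix (hinv _ hr).1 (hinv _ hr).2
  refine ⟨γ, Γ, hf, hinv, fun p₀ => ?_⟩
  rw [← hE]
  exact hubbardRingTV_re_rdmEnergy_eq_mul_site hL t U hf.dqg.herm_one hf.dqg.swap_fst hf.dqg.swap_snd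
    hγ hΓ p₀

end Singlet

/-! ## §2 The certified gap per site as a bond excess plus a doublon deficit -/

section Gap

variable {n : ℕ} {t U : ℚ} {ψ : Fock (Orb (Fin (2 * n)))}
  {γ : Matrix (Orb (Fin (2 * n))) (Orb (Fin (2 * n))) ℂ}
  {Γ : Matrix (Orb (Fin (2 * n)) × Orb (Fin (2 * n))) (Orb (Fin (2 * n)) × Orb (Fin (2 * n))) ℂ}

/-- **THE GAP DECOMPOSITION, SECTOR LEVEL.** On the half-filled even ring `L = 2n ≥ 4` (`t ≠ 0`, `U > 0`):
for a UNIT ground state `ψ` and a rotation-invariant OPTIMAL pair `(γ, Γ)` of the `(n, n)` sector programme,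
at every site `p₀` and spin `σ₀`,
`E₀ − OPT_DQG = 2n · (2t·(Σ_σ Re γ_{p₀σ,(p₀+1)σ} − 2 Re B) + U·(Re D − Re Γ_{(p₀↑,p₀↓),(p₀↑,p₀↓)}))`
with `B = ⟨c†_{p₀σ₀} c_{(p₀+1)σ₀}⟩_ψ`, `D = ⟨n_{p₀↑} n_{p₀↓}⟩_ψ`: the certified gap per site is `2t×` the
optimiser's BOND EXCESS plus `U×` its DOUBLON DEFICIT relative to the exact ground state. [folklore] -/
theorem hubbardRingTV_gap_sector_eq_mul_site (hn : 2 ≤ n) (ht : t ≠ 0) (hU : 0 < U)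
    (hψ : IsGroundState (hubbardRingTV (2 * n) t U).hamiltonian (2 * n) ψ) (hψ1 : star ψ ⬝ᵥ ψ = 1)
    (hf : IsDQGFeasibleSector n n γ Γ)
    (hopt : (rdmEnergy (fun p q => ((hubbardRingTV (2 * n) t U).h p q : ℂ))
        (fun p q r s => ((hubbardRingTV (2 * n) t U).eri p q r s : ℂ))
        ((hubbardRingTV (2 * n) t U).ecore : ℂ) γ Γ).re = Model.pqgSectorEnergy (hubbardRingTV (2 * n) t U) n n)
    (hγ : ∀ (p q : Fin (2 * n)) (σ τ : Fin 2),
      γ (orb (finRotate (2 * n) p) σ) (orb (finRotate (2 * n) q) τ) = γ (orb p σ) (orb q τ))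
    (hΓ : ∀ (p q r s : Fin (2 * n)) (σ τ υ φ : Fin 2),
      Γ (orb (finRotate (2 * n) p) σ, orb (finRotate (2 * n) q) τ) (orb (finRotate (2 * n) r) υ,
          orb (finRotate (2 * n) s) φ) = Γ (orb p σ, orb q τ) (orb r υ, orb s φ))
    (p₀ : Fin (2 * n)) (σ₀ : Fin 2) :
    Model.energy (hubbardRingTV (2 * n) t U) n n - Model.pqgSectorEnergy (hubbardRingTV (2 * n) t U) n n =
      (2 * n : ℕ) * (2 * (t : ℝ) * (∑ σ : Fin 2, (γ (orb p₀ σ) (orb (finRotate (2 * n) p₀) σ)).re -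
          2 * (expect (creation (orb p₀ σ₀) * annihilation (orb (finRotate (2 * n) p₀) σ₀)) ψ).re) +
        (U : ℝ) * ((expect (numberOp p₀ 0 * numberOp p₀ 1) ψ).re -
          (Γ (orb p₀ 0, orb p₀ 1) (orb p₀ 0, orb p₀ 1)).re)) := by
  rw [hubbardRingTV_energy_eq_mul_site hn ht hU hψ hψ1 p₀ σ₀, ← hopt,
    hubbardRingTV_re_rdmEnergy_eq_mul_site (by omega) t U hf.dqg.herm_one hf.dqg.swap_fst hf.dqg.swap_snd
      hγ hΓ p₀]
  push_cast
  ring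

/-- **THE DOUBLON EXCESS OF THE OPTIMISER IS PAID FOR IN BOND AMPLITUDE**: under the hypotheses of the
decomposition, `U·(Re d − Re D) ≤ 2t·(Σ_σ Re b_σ − 2 Re B)` (`d`, `b_σ` the optimiser's doublon / bond
entries, `D`, `B` the ground state's): the relaxation lies below the exact energy
(`pqgSectorEnergy_le_sectorGroundEnergy`), so if it carries MORE doublons than the ground state it carries
MORE bond amplitude too — HOME/STRUCTURE §2.2.8 (vi)'s 'delocalisation' sentence as an exact inequality
between the two primal observables, at every `(t, U)`, no asymptotics. [folklore] -/
theorem hubbardRingTV_doublonExcess_le_bondExcess (hn : 2 ≤ n) (ht : t ≠ 0) (hU : 0 < U)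
    (hψ : IsGroundState (hubbardRingTV (2 * n) t U).hamiltonian (2 * n) ψ) (hψ1 : star ψ ⬝ᵥ ψ = 1)
    (hf : IsDQGFeasibleSector n n γ Γ)
    (hopt : (rdmEnergy (fun p q => ((hubbardRingTV (2 * n) t U).h p q : ℂ))
        (fun p q r s => ((hubbardRingTV (2 * n) t U).eri p q r s : ℂ))
        ((hubbardRingTV (2 * n) t U).ecore : ℂ) γ Γ).re = Model.pqgSectorEnergy (hubbardRingTV (2 * n) t U) n n)
    (hγ : ∀ (p q : Fin (2 * n)) (σ τ : Fin 2),
      γ (orb (finRotate (2 * n) p) σ) (orb (finRotate (2 * n) q) τ) = γ (orb p σ) (orb q τ))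
    (hΓ : ∀ (p q r s : Fin (2 * n)) (σ τ υ φ : Fin 2),
      Γ (orb (finRotate (2 * n) p) σ, orb (finRotate (2 * n) q) τ) (orb (finRotate (2 * n) r) υ,
          orb (finRotate (2 * n) s) φ) = Γ (orb p σ, orb q τ) (orb r υ, orb s φ))
    (p₀ : Fin (2 * n)) (σ₀ : Fin 2) :
    (U : ℝ) * ((Γ (orb p₀ 0, orb p₀ 1) (orb p₀ 0, orb p₀ 1)).re - (expect (numberOp p₀ 0 * numberOp p₀ 1) ψ).re) ≤
      2 * (t : ℝ) * (∑ σ : Fin 2, (γ (orb p₀ σ) (orb (finRotate (2 * n) p₀) σ)).re -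
        2 * (expect (creation (orb p₀ σ₀) * annihilation (orb (finRotate (2 * n) p₀) σ₀)) ψ).re) := by
  have hgap : 0 ≤ Model.energy (hubbardRingTV (2 * n) t U) n n - Model.pqgSectorEnergy (hubbardRingTV (2 * n) t U) n n :=
    sub_nonneg.2 (pqgSectorEnergy_le_sectorGroundEnergy (hubbardRingTV_hamiltonian_isHermitian (2 * n) t U)
      (by rw [Fintype.card_fin]; omega) (by rw [Fintype.card_fin]; omega))
  rw [hubbardRingTV_gap_sector_eq_mul_site hn ht hU hψ hψ1 hf hopt hγ hΓ p₀ σ₀] at hgap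
  have hn' : (0 : ℝ) < (2 * n : ℕ) := by exact_mod_cast (by omega : 0 < 2 * n)
  have h := (mul_nonneg_iff_of_pos_left hn').1 hgap
  linarith

/-- **A ONE-SIDED FORM OF THE DECOMPOSITION**: `E₀ − OPT_DQG ≤ 2n·(2t·(Σ_σ Re b_σ − 2 Re B) + U·Re D)`
(drop the optimiser's non-negative doublon entry `Re d ≥ 0`, a diagonal entry of the PSD `Γ`): the certified
gap per site is at most the bond excess plus the ground state's own interaction energy per site. [folklore] -/
theorem hubbardRingTV_gap_sector_le_bondExcess_add (hn : 2 ≤ n) (ht : t ≠ 0) (hU : 0 < U)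
    (hψ : IsGroundState (hubbardRingTV (2 * n) t U).hamiltonian (2 * n) ψ) (hψ1 : star ψ ⬝ᵥ ψ = 1)
    (hf : IsDQGFeasibleSector n n γ Γ)
    (hopt : (rdmEnergy (fun p q => ((hubbardRingTV (2 * n) t U).h p q : ℂ))
        (fun p q r s => ((hubbardRingTV (2 * n) t U).eri p q r s : ℂ))
        ((hubbardRingTV (2 * n) t U).ecore : ℂ) γ Γ).re = Model.pqgSectorEnergy (hubbardRingTV (2 * n) t U) n n)
    (hγ : ∀ (p q : Fin (2 * n)) (σ τ : Fin 2),
      γ (orb (finRotate (2 * n) p) σ) (orb (finRotate (2 * n) q) τ) = γ (orb p σ) (orb q τ))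
    (hΓ : ∀ (p q r s : Fin (2 * n)) (σ τ υ φ : Fin 2),
      Γ (orb (finRotate (2 * n) p) σ, orb (finRotate (2 * n) q) τ) (orb (finRotate (2 * n) r) υ,
          orb (finRotate (2 * n) s) φ) = Γ (orb p σ, orb q τ) (orb r υ, orb s φ))
    (p₀ : Fin (2 * n)) (σ₀ : Fin 2) :
    Model.energy (hubbardRingTV (2 * n) t U) n n - Model.pqgSectorEnergy (hubbardRingTV (2 * n) t U) n n ≤
      (2 * n : ℕ) * (2 * (t : ℝ) * (∑ σ : Fin 2, (γ (orb p₀ σ) (orb (finRotate (2 * n) p₀) σ)).re -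
          2 * (expect (creation (orb p₀ σ₀) * annihilation (orb (finRotate (2 * n) p₀) σ₀)) ψ).re) +
        (U : ℝ) * (expect (numberOp p₀ 0 * numberOp p₀ 1) ψ).re) := by
  rw [hubbardRingTV_gap_sector_eq_mul_site hn ht hU hψ hψ1 hf hopt hγ hΓ p₀ σ₀]
  have hd : 0 ≤ (Γ (orb p₀ 0, orb p₀ 1) (orb p₀ 0, orb p₀ 1)).re :=
    (Complex.nonneg_iff.1 (hf.dqg.d_psd.diag_nonneg (i := (orb p₀ 0, orb p₀ 1)))).1
  have hn' : (0 : ℝ) ≤ (2 * n : ℕ) := by positivity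
  have hU' : (0 : ℝ) ≤ U := by exact_mod_cast hU.le
  nlinarith [mul_nonneg hU' hd]

end Gap

/-! ## §3 The singlet level and the existence form -/

section Singlet2

variable {n : ℕ} {t U : ℚ} {ψ : Fock (Orb (Fin (2 * n)))}
  {γ : Matrix (Orb (Fin (2 * n))) (Orb (Fin (2 * n))) ℂ}
  {Γ : Matrix (Orb (Fin (2 * n)) × Orb (Fin (2 * n))) (Orb (Fin (2 * n)) × Orb (Fin (2 * n))) ℂ}

/-- **THE GAP DECOMPOSITION, SINGLET LEVEL** (`L = 2n ≥ 4`, `t ≠ 0`, `U > 0`): for a unit ground state `ψ`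
and a rotation-invariant OPTIMAL pair of the singlet-restricted programme,
`E₀ − OPT_DQG+S² = 2n · (2t·(Σ_σ Re γ_{p₀σ,(p₀+1)σ} − 2 Re B) + U·(Re D − Re Γ_{(p₀↑,p₀↓),(p₀↑,p₀↓)}))`.
[folklore] -/
theorem hubbardRingTV_gap_singlet_eq_mul_site (hn : 2 ≤ n) (ht : t ≠ 0) (hU : 0 < U)
    (hψ : IsGroundState (hubbardRingTV (2 * n) t U).hamiltonian (2 * n) ψ) (hψ1 : star ψ ⬝ᵥ ψ = 1)
    (hf : IsDQGFeasibleSinglet n γ Γ)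
    (hopt : (rdmEnergy (fun p q => ((hubbardRingTV (2 * n) t U).h p q : ℂ))
        (fun p q r s => ((hubbardRingTV (2 * n) t U).eri p q r s : ℂ))
        ((hubbardRingTV (2 * n) t U).ecore : ℂ) γ Γ).re = Model.pqgSingletEnergy (hubbardRingTV (2 * n) t U) n)
    (hγ : ∀ (p q : Fin (2 * n)) (σ τ : Fin 2),
      γ (orb (finRotate (2 * n) p) σ) (orb (finRotate (2 * n) q) τ) = γ (orb p σ) (orb q τ))
    (hΓ : ∀ (p q r s : Fin (2 * n)) (σ τ υ φ : Fin 2),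
      Γ (orb (finRotate (2 * n) p) σ, orb (finRotate (2 * n) q) τ) (orb (finRotate (2 * n) r) υ,
          orb (finRotate (2 * n) s) φ) = Γ (orb p σ, orb q τ) (orb r υ, orb s φ))
    (p₀ : Fin (2 * n)) (σ₀ : Fin 2) :
    Model.energy (hubbardRingTV (2 * n) t U) n n - Model.pqgSingletEnergy (hubbardRingTV (2 * n) t U) n =
      (2 * n : ℕ) * (2 * (t : ℝ) * (∑ σ : Fin 2, (γ (orb p₀ σ) (orb (finRotate (2 * n) p₀) σ)).re -
          2 * (expect (creation (orb p₀ σ₀) * annihilation (orb (finRotate (2 * n) p₀) σ₀)) ψ).re) +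
        (U : ℝ) * ((expect (numberOp p₀ 0 * numberOp p₀ 1) ψ).re -
          (Γ (orb p₀ 0, orb p₀ 1) (orb p₀ 0, orb p₀ 1)).re)) := by
  rw [hubbardRingTV_energy_eq_mul_site hn ht hU hψ hψ1 p₀ σ₀, ← hopt,
    hubbardRingTV_re_rdmEnergy_eq_mul_site (by omega) t U hf.dqg.herm_one hf.dqg.swap_fst hf.dqg.swap_snd
      hγ hΓ p₀]
  push_cast
  ring

/-- **Singlet level: the doublon excess is paid for in bond amplitude** — `U·(Re d − Re D) ≤
2t·(Σ_σ Re b_σ − 2 Re B)` at a rotation-invariant singlet optimum (`OPT_DQG+S² ≤ E₀` on the half-filled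
even ring, gen 38's `hubbardRingTV_pqgSingletEnergy_le_energy`). [folklore] -/
theorem hubbardRingTV_doublonExcess_le_bondExcess_singlet (hn : 2 ≤ n) (ht : t ≠ 0) (hU : 0 < U)
    (hψ : IsGroundState (hubbardRingTV (2 * n) t U).hamiltonian (2 * n) ψ) (hψ1 : star ψ ⬝ᵥ ψ = 1)
    (hf : IsDQGFeasibleSinglet n γ Γ)
    (hopt : (rdmEnergy (fun p q => ((hubbardRingTV (2 * n) t U).h p q : ℂ))
        (fun p q r s => ((hubbardRingTV (2 * n) t U).eri p q r s : ℂ))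
        ((hubbardRingTV (2 * n) t U).ecore : ℂ) γ Γ).re = Model.pqgSingletEnergy (hubbardRingTV (2 * n) t U) n)
    (hγ : ∀ (p q : Fin (2 * n)) (σ τ : Fin 2),
      γ (orb (finRotate (2 * n) p) σ) (orb (finRotate (2 * n) q) τ) = γ (orb p σ) (orb q τ))
    (hΓ : ∀ (p q r s : Fin (2 * n)) (σ τ υ φ : Fin 2),
      Γ (orb (finRotate (2 * n) p) σ, orb (finRotate (2 * n) q) τ) (orb (finRotate (2 * n) r) υ,
          orb (finRotate (2 * n) s) φ) = Γ (orb p σ, orb q τ) (orb r υ, orb s φ))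
    (p₀ : Fin (2 * n)) (σ₀ : Fin 2) :
    (U : ℝ) * ((Γ (orb p₀ 0, orb p₀ 1) (orb p₀ 0, orb p₀ 1)).re - (expect (numberOp p₀ 0 * numberOp p₀ 1) ψ).re) ≤
      2 * (t : ℝ) * (∑ σ : Fin 2, (γ (orb p₀ σ) (orb (finRotate (2 * n) p₀) σ)).re -
        2 * (expect (creation (orb p₀ σ₀) * annihilation (orb (finRotate (2 * n) p₀) σ₀)) ψ).re) := by
  have hgap : 0 ≤ Model.energy (hubbardRingTV (2 * n) t U) n n - Model.pqgSingletEnergy (hubbardRingTV (2 * n) t U) n :=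
    sub_nonneg.2 (hubbardRingTV_pqgSingletEnergy_le_energy (n := n) (by omega) t hU)
  rw [hubbardRingTV_gap_singlet_eq_mul_site hn ht hU hψ hψ1 hf hopt hγ hΓ p₀ σ₀] at hgap
  have hn' : (0 : ℝ) < (2 * n : ℕ) := by exact_mod_cast (by omega : 0 < 2 * n)
  have h := (mul_nonneg_iff_of_pos_left hn').1 hgap
  linarith

/-- **EXISTENCE FORM (both levels).** On the half-filled even ring `L = 2n ≥ 4` (`t ≠ 0`, `U > 0`), for
every unit ground state `ψ` there are OPTIMAL pairs of the sector programme and of the singlet-restricted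
programme, each dihedral-invariant, whose doublon excess over `ψ` at any site is bounded by `2t/U ×` their
bond excess: `U·(Re d − Re D) ≤ 2t·(Σ_σ Re b_σ − 2 Re B)`. [folklore] -/
theorem hubbardRingTV_exists_optima_doublonExcess_le_bondExcess (hn : 2 ≤ n) (ht : t ≠ 0) (hU : 0 < U)
    (hψ : IsGroundState (hubbardRingTV (2 * n) t U).hamiltonian (2 * n) ψ) (hψ1 : star ψ ⬝ᵥ ψ = 1)
    (p₀ : Fin (2 * n)) (σ₀ : Fin 2) :
    (∃ γ Γ, IsDQGFeasibleSector n n γ Γ ∧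
      (rdmEnergy (fun p q => ((hubbardRingTV (2 * n) t U).h p q : ℂ))
        (fun p q r s => ((hubbardRingTV (2 * n) t U).eri p q r s : ℂ))
        ((hubbardRingTV (2 * n) t U).ecore : ℂ) γ Γ).re = Model.pqgSectorEnergy (hubbardRingTV (2 * n) t U) n n ∧
      (U : ℝ) * ((Γ (orb p₀ 0, orb p₀ 1) (orb p₀ 0, orb p₀ 1)).re -
          (expect (numberOp p₀ 0 * numberOp p₀ 1) ψ).re) ≤
        2 * (t : ℝ) * (∑ σ : Fin 2, (γ (orb p₀ σ) (orb (finRotate (2 * n) p₀) σ)).re -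
          2 * (expect (creation (orb p₀ σ₀) * annihilation (orb (finRotate (2 * n) p₀) σ₀)) ψ).re)) ∧
    (∃ γ Γ, IsDQGFeasibleSinglet n γ Γ ∧
      (rdmEnergy (fun p q => ((hubbardRingTV (2 * n) t U).h p q : ℂ))
        (fun p q r s => ((hubbardRingTV (2 * n) t U).eri p q r s : ℂ))
        ((hubbardRingTV (2 * n) t U).ecore : ℂ) γ Γ).re = Model.pqgSingletEnergy (hubbardRingTV (2 * n) t U) n ∧
      (U : ℝ) * ((Γ (orb p₀ 0, orb p₀ 1) (orb p₀ 0, orb p₀ 1)).re -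
          (expect (numberOp p₀ 0 * numberOp p₀ 1) ψ).re) ≤
        2 * (t : ℝ) * (∑ σ : Fin 2, (γ (orb p₀ σ) (orb (finRotate (2 * n) p₀) σ)).re -
          2 * (expect (creation (orb p₀ σ₀) * annihilation (orb (finRotate (2 * n) p₀) σ₀)) ψ).re)) := by
  have hr : finRotate (2 * n) ∈
      Subgroup.closure ({finRotate (2 * n), Fin.revPerm} : Set (Equiv.Perm (Fin (2 * n)))) :=
    Subgroup.subset_closure (Set.mem_insert _ _)
  constructor
  · obtain ⟨γ, Γ, hf, hinv, hE⟩ :=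
      hubbardRingTV_exists_dihedral_optimum (L := 2 * n) t U (show n ≤ 2 * n by omega) (show n ≤ 2 * n by omega)
    obtain ⟨hγ, hΓ⟩ := entrywise_of_submatrix (hinv _ hr).1 (hinv _ hr).2
    exact ⟨γ, Γ, hf, hE, hubbardRingTV_doublonExcess_le_bondExcess hn ht hU hψ hψ1 hf hE hγ hΓ p₀ σ₀⟩
  · obtain ⟨γ, Γ, hf, hinv, hE⟩ :=
      hubbardRingTV_exists_dihedral_singlet_optimum (L := 2 * n) t U (show n ≤ 2 * n by omega)
    obtain ⟨hγ, hΓ⟩ := entrywise_of_submatrix (hinv _ hr).1 (hinv _ hr).2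
    exact ⟨γ, Γ, hf, hE, hubbardRingTV_doublonExcess_le_bondExcess_singlet hn ht hU hψ hψ1 hf hE hγ hΓ p₀ σ₀⟩

end Singlet2

/-! ## §4 The two readings jointly: linear majorants of `OPT_DQG` and `E₀` over the whole `(t, U)` plane -/

section Plane

variable {L : ℕ} {γ : Matrix (Orb (Fin L)) (Orb (Fin L)) ℂ}
  {Γ : Matrix (Orb (Fin L) × Orb (Fin L)) (Orb (Fin L) × Orb (Fin L)) ℂ}

/-- **A ROTATION-INVARIANT FEASIBLE PAIR MAJORISES `OPT_DQG` LINEARLY ON THE WHOLE PLANE** (`L ≥ 3`):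
for every `(t′, U′)`, `OPT_DQG(L; t′, U′; a, b) ≤ L·(−2t′·Σ_σ Re γ_{p₀σ,(p₀+1)σ} + U′·Re Γ_{(p₀↑,p₀↓),(p₀↑,p₀↓)})`
(the feasible set does not depend on `(t, U)`; the functional at the pair is this linear form by the
ring energy formula) — with EQUALITY at `(t, U)` when the pair is optimal there: the pair's
`(−2K, s)` is a joint supergradient and Euler's identity holds (`OPT` is positively homogeneous).
[folklore] -/
theorem hubbardRingTV_pqgSectorEnergy_le_mul_site (hL : 3 ≤ L) (t' U' : ℚ) {a b : ℕ}
    (hf : IsDQGFeasibleSector a b γ Γ)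
    (hγ : ∀ (p q : Fin L) (σ τ : Fin 2), γ (orb (finRotate L p) σ) (orb (finRotate L q) τ) = γ (orb p σ) (orb q τ))
    (hΓ : ∀ (p q r s : Fin L) (σ τ υ φ : Fin 2),
      Γ (orb (finRotate L p) σ, orb (finRotate L q) τ) (orb (finRotate L r) υ, orb (finRotate L s) φ) =
        Γ (orb p σ, orb q τ) (orb r υ, orb s φ))
    (p₀ : Fin L) :
    Model.pqgSectorEnergy (hubbardRingTV L t' U') a b ≤
      L * (-2 * (t' : ℝ) * ∑ σ : Fin 2, (γ (orb p₀ σ) (orb (finRotate L p₀) σ)).re +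
        (U' : ℝ) * (Γ (orb p₀ 0, orb p₀ 1) (orb p₀ 0, orb p₀ 1)).re) := by
  rw [← hubbardRingTV_re_rdmEnergy_eq_mul_site hL t' U' hf.dqg.herm_one hf.dqg.swap_fst hf.dqg.swap_snd
    hγ hΓ p₀]
  exact pqgSectorEnergy_le_rdmEnergy _ _ _ hf

variable {n : ℕ} {t U : ℚ} {ψ : Fock (Orb (Fin (2 * n)))}

/-- **`⟨ψ, H(t′, U′) ψ⟩ = 2n·(−4t′·B + U′·D)` for a ground state `ψ` of `hubbardRingTV (2n) t U`** (`n ≥ 2`,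
`t ≠ 0`, `U > 0`; every `t′, U′`; `B`, `D` the ground state's bond amplitude and double occupancy at any
site / spin). [folklore] -/
theorem hubbardRingTV_groundState_expect_eq_mul_site_plane (hn : 2 ≤ n) (ht : t ≠ 0) (hU : 0 < U)
    (hψ : IsGroundState (hubbardRingTV (2 * n) t U).hamiltonian (2 * n) ψ) (t' U' : ℚ) (p₀ : Fin (2 * n))
    (σ₀ : Fin 2) :
    expect (hubbardRingTV (2 * n) t' U').hamiltonian ψ =
      ((2 * n : ℕ) : ℂ) * (-(4 * (t' : ℂ)) * expect (creation (orb p₀ σ₀) * annihilation (orb (finRotate (2 * n) p₀) σ₀)) ψ +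
        (U' : ℂ) * expect (numberOp p₀ 0 * numberOp p₀ 1) ψ) := by
  have hn1 : 1 ≤ n := by omega
  rw [hubbardRingTV_expect_eq (by omega) t' U' ψ,
    Finset.sum_congr rfl fun x _ => Finset.sum_congr rfl fun σ _ => by
      rw [hubbardRingTV_groundState_bond_reverse hn1 ht hU hψ x σ,
        hubbardRingTV_groundState_bond_eq hn1 ht hU hψ x p₀ σ σ₀],
    Finset.sum_congr rfl fun x _ => hubbardRingTV_groundState_doubleOccupancy_eq hn1 ht hU hψ x p₀]
  simp only [Finset.sum_const, Finset.card_univ, Fintype.card_fin, nsmul_eq_mul]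
  push_cast
  ring

/-- **THE GROUND STATE MAJORISES `E₀` LINEARLY ON THE WHOLE PLANE**: for a unit ground state `ψ` of
`hubbardRingTV (2n) t U` (`n ≥ 2`, `t ≠ 0`, `U > 0`) and EVERY `(t′, U′)`:
`E₀(2n; t′, U′; n, n) ≤ 2n·(−4t′·Re B + U′·Re D)`, with equality at `(t′, U′) = (t, U)` (the sibling's
intensive identity) — `(−8n Re B, 2n Re D)` is a joint supergradient of the concave, positively
homogeneous `E₀` at `(t, U)`, uniting the hopping (this gen) and the repulsion (gen 38) Feynman–Hellmann
inequalities. [folklore] -/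
theorem hubbardRingTV_energy_le_mul_site_plane (hn : 2 ≤ n) (ht : t ≠ 0) (hU : 0 < U)
    (hψ : IsGroundState (hubbardRingTV (2 * n) t U).hamiltonian (2 * n) ψ) (hψ1 : star ψ ⬝ᵥ ψ = 1)
    (t' U' : ℚ) (p₀ : Fin (2 * n)) (σ₀ : Fin 2) :
    Model.energy (hubbardRingTV (2 * n) t' U') n n ≤
      (2 * n : ℕ) * (-4 * (t' : ℝ) * (expect (creation (orb p₀ σ₀) * annihilation (orb (finRotate (2 * n) p₀) σ₀)) ψ).re +
        (U' : ℝ) * (expect (numberOp p₀ 0 * numberOp p₀ 1) ψ).re) := by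
  have hn1 : 1 ≤ n := by omega
  have hsec := hubbardRingTV_groundState_isInSector hn1 ht hU hψ
  refine sectorGroundEnergy_le_of_rayleigh (hubbardRingTV_hamiltonian_isHermitian (2 * n) t' U') hsec hψ.2.1 ?_
  rw [hψ1, Complex.one_re, mul_one]
  have h := congrArg Complex.re (hubbardRingTV_groundState_expect_eq_mul_site_plane hn ht hU hψ t' U' p₀ σ₀)
  rw [← Complex.ofReal_ratCast, ← Complex.ofReal_ratCast] at h
  simp only [Complex.mul_re, Complex.add_re, Complex.neg_re, Complex.neg_im, Complex.ofReal_re,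
    Complex.ofReal_im, Complex.natCast_re, Complex.natCast_im, Complex.re_ofNat, Complex.im_ofNat,
    Complex.mul_im, zero_mul, sub_zero, add_zero, mul_zero] at h
  rw [Literature.MathematicalPhysics.QuantumLattice.expect] at h
  rw [h]
  push_cast
  exact le_of_eq (by ring)

end Plane

end RingEnergy

end Summit.Ventures.CertifiedQuantumChemistry

end
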